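import Mathlib
import Literature.Analysis.ODE.InverseSquareLadder
import Literature.Analysis.ODE.InverseSquareLadderExpansion
import Literature.Analysis.Calculus.HardyChainHalfLine
import HarnessLib

/-!
# Coercivity of the Darboux ladder modulo Taylor polynomials (Hardy chains)

Analysis/ODE support file (everything proved). Let `ι` be smooth with `ι = 1/x` on `[½, ∞)` and
`1 ≤ R ≤ X`. Combining the expansion `ladder ι n k = Σ_{j≤n} β_j x^{j−n} k^{(j)}`
(`InverseSquareLadderExpansion.lean`) with the Hardy chains of `HardyChainHalfLine.lean`:
* `exists_ladder_weighted_sq_integral_le` (core): for `n ≤ p`, `1 ≤ p`, `k ∈ C^p` with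
  `k^{(j)}(R) = 0 (j < p)`: `∫_R^X (ladder ι n k)²/x^{2(p−n)} ≤ C ∫_R^X (k^{(p)})²`;
* `exists_ladder_sq_integral_le` (velocity data, `p = n`):
  `∫_R^X (ladder ι n k)² ≤ C ∫_R^X (k^{(n)})²`;
* `exists_ladder_energy_integral_le` (position data, `p = n+1`):
  `∫_R^X ((ladder ι n k)')² + n(n+1)ι²(ladder ι n k)² ≤ C ∫_R^X (k^{(n+1)})²`,
with constants depending only on `n` (and the fixed coefficient `ι`). This is the coercivity half
("energy of the data modulo the kernel is controlled by the outgoing profiles") of the exact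
inverse-square exterior channel estimate (route PhotonSphereChannels, `FixedModeChannels`, far side,
stmt-FinalStateConjecture-10048). Folklore.
-/

noncomputable section

namespace Literature.Analysis.ODE

open Set Filter Topology Finset MeasureTheory Literature.Analysis.Calculus

variable {ι : ℝ → ℝ}

/-- **Core weighted estimate.** See the module docstring. [folklore] -/
theorem exists_ladder_weighted_sq_integral_le (hι : ContDiff ℝ (⊤ : ℕ∞) ι)
    (hιeq : ∀ x : ℝ, 1 / 2 ≤ x → ι x = x⁻¹) (n p : ℕ) (hnp : n ≤ p) (hp : 1 ≤ p) :
    ∃ C : ℝ, 0 ≤ C ∧ ∀ k : ℝ → ℝ, ContDiff ℝ p k → ∀ R X : ℝ, 1 ≤ R → R ≤ X →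
      (∀ j < p, iteratedDeriv j k R = 0) →
      ∫ x in R..X, (ladder ι n k x) ^ 2 / x ^ (2 * (p - n))
        ≤ C * ∫ x in R..X, iteratedDeriv p k x ^ 2 := by
  have hSo : IsOpen (Ioi (1 / 2 : ℝ)) := isOpen_Ioi
  have hric : ∀ x ∈ Ioi (1 / 2 : ℝ), deriv ι x = -(ι x) ^ 2 := by
    intro x hx
    have hx' : (1 / 2 : ℝ) < x := hx
    have hx0 : x ≠ 0 := by intro h; rw [h] at hx'; norm_num at hx'
    have hev : ι =ᶠ[𝓝 x] fun y => y⁻¹ :=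
      Filter.mem_of_superset (Ioi_mem_nhds hx') fun y hy => hιeq y (le_of_lt hy)
    rw [hev.deriv_eq, deriv_inv, hιeq x hx'.le]; field_simp
  obtain ⟨β, -, hexp⟩ := exists_ladder_expansion hι hSo hric n
  refine ⟨((n : ℝ) + 1) * ∑ j ∈ range (n + 1), β j ^ 2 * 4 ^ (p - j), by positivity, ?_⟩
  intro k hk R X hR hRX hvan
  -- the Hardy level `ℓ + 1 = p`
  obtain ⟨ℓ, rfl⟩ : ∃ ℓ, p = ℓ + 1 := ⟨p - 1, by omega⟩
  have hkℓ : ContDiff ℝ (ℓ + 1) k := by exact_mod_cast hk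
  have hvan' : ∀ j ≤ ℓ, iteratedDeriv j k R = 0 := fun j hj => hvan j (by omega)
  have hR0 : 0 < R := by linarith
  -- pointwise bound on `[R, X]`
  have hpt : ∀ x ∈ Icc R X, (ladder ι n k x) ^ 2 / x ^ (2 * (ℓ + 1 - n))
      ≤ ((n : ℝ) + 1) * ∑ j ∈ range (n + 1),
          β j ^ 2 * (iteratedDeriv j k x ^ 2 / x ^ (2 * (ℓ + 1 - j))) := by
    intro x hx
    have hx1 : 1 ≤ x := hR.trans hx.1
    have hx0 : 0 < x := by linarith
    have hxS : x ∈ Ioi (1 / 2 : ℝ) := show (1 / 2 : ℝ) < x by linarith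
    rw [hexp k (hk.of_le (by exact_mod_cast hnp)) x hxS, hιeq x (by linarith)]
    have hcs := sq_sum_le_card_mul_sum_sq (s := range (n + 1))
      (f := fun j => β j * x⁻¹ ^ (n - j) * iteratedDeriv j k x)
    rw [card_range] at hcs
    have hxp : 0 < x ^ (2 * (ℓ + 1 - n)) := pow_pos hx0 _
    rw [div_le_iff₀ hxp]
    refine hcs.trans ?_
    push_cast
    rw [mul_assoc, Finset.sum_mul]
    refine mul_le_mul_of_nonneg_left (le_of_eq (Finset.sum_congr rfl fun j hj => ?_))
      (by positivity)
    have hjn : j ≤ n := Nat.lt_succ_iff.1 (mem_range.1 hj)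
    have e1 : (x ^ (2 * (ℓ + 1 - j)) : ℝ) = x ^ (2 * (n - j)) * x ^ (2 * (ℓ + 1 - n)) := by
      rw [← pow_add]; congr 1; omega
    rw [e1, inv_pow]
    field_simp
    ring
  -- integrability of everything on `[R, X]`
  have hcontj : ∀ j ≤ ℓ + 1, Continuous (iteratedDeriv j k) := fun j hj =>
    hk.continuous_iteratedDeriv j (by exact_mod_cast hj)
  have hIw : ∀ (j q : ℕ), j ≤ ℓ + 1 →
      IntervalIntegrable (fun x => iteratedDeriv j k x ^ 2 / x ^ q) volume R X := by
    intro j q hj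
    refine (ContinuousOn.div ((hcontj j hj).pow 2).continuousOn (continuousOn_pow q)
      ?_).intervalIntegrable
    intro x hx
    rw [uIcc_of_le hRX] at hx
    exact pow_ne_zero _ (by linarith [hx.1] : x ≠ 0)
  have hladC : Continuous (ladder ι n k) :=
    (contDiff_ladder hι (m := 0) (by simpa using hk.of_le (by exact_mod_cast hnp))).continuous
  have hIl : IntervalIntegrable (fun x => (ladder ι n k x) ^ 2 / x ^ (2 * (ℓ + 1 - n)))
      volume R X := by
    refine (ContinuousOn.div (hladC.pow 2).continuousOn (continuousOn_pow _) ?_).intervalIntegrable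
    intro x hx
    rw [uIcc_of_le hRX] at hx
    exact pow_ne_zero _ (by linarith [hx.1] : x ≠ 0)
  have hIs : IntervalIntegrable (fun x => ((n : ℝ) + 1) * ∑ j ∈ range (n + 1),
      β j ^ 2 * (iteratedDeriv j k x ^ 2 / x ^ (2 * (ℓ + 1 - j)))) volume R X := by
    have e : (fun x : ℝ => ∑ j ∈ range (n + 1),
        β j ^ 2 * (iteratedDeriv j k x ^ 2 / x ^ (2 * (ℓ + 1 - j))))
        = ∑ j ∈ range (n + 1), fun x : ℝ =>
            β j ^ 2 * (iteratedDeriv j k x ^ 2 / x ^ (2 * (ℓ + 1 - j))) := by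
      funext x
      exact (Finset.sum_apply x (range (n + 1)) (fun j (y : ℝ) =>
        β j ^ 2 * (iteratedDeriv j k y ^ 2 / y ^ (2 * (ℓ + 1 - j))))).symm
    have hS : IntervalIntegrable (fun x : ℝ => ∑ j ∈ range (n + 1),
        β j ^ 2 * (iteratedDeriv j k x ^ 2 / x ^ (2 * (ℓ + 1 - j)))) volume R X := by
      rw [e]
      exact IntervalIntegrable.sum _ fun j hj =>
        (hIw j _ (by have := mem_range.1 hj; omega)).const_mul _
    exact hS.const_mul _
  -- integrate and apply the Hardy chain termwise
  calc ∫ x in R..X, (ladder ι n k x) ^ 2 / x ^ (2 * (ℓ + 1 - n))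
      ≤ ∫ x in R..X, ((n : ℝ) + 1) * ∑ j ∈ range (n + 1),
          β j ^ 2 * (iteratedDeriv j k x ^ 2 / x ^ (2 * (ℓ + 1 - j))) :=
        intervalIntegral.integral_mono_on hRX hIl hIs hpt
    _ = ((n : ℝ) + 1) * ∑ j ∈ range (n + 1),
          β j ^ 2 * ∫ x in R..X, iteratedDeriv j k x ^ 2 / x ^ (2 * (ℓ + 1 - j)) := by
        rw [intervalIntegral.integral_const_mul, intervalIntegral.integral_finsetSum
          (f := fun j x => β j ^ 2 * (iteratedDeriv j k x ^ 2 / x ^ (2 * (ℓ + 1 - j))))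
          fun j hj => (hIw j _ (by have := mem_range.1 hj; omega)).const_mul _]
        congr 1
        refine Finset.sum_congr rfl fun j _ => ?_
        exact intervalIntegral.integral_const_mul _ _
    _ ≤ ((n : ℝ) + 1) * ∑ j ∈ range (n + 1),
          β j ^ 2 * (4 ^ (ℓ + 1 - j) * ∫ x in R..X, iteratedDeriv (ℓ + 1) k x ^ 2) := by
        refine mul_le_mul_of_nonneg_left (Finset.sum_le_sum fun j hj => ?_) (by positivity)
        have hjn : j ≤ n := Nat.lt_succ_iff.1 (mem_range.1 hj)
        exact mul_le_mul_of_nonneg_left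
          (hardy_chain_iteratedDeriv_le' hkℓ hR0 hRX hvan' (by omega)) (sq_nonneg _)
    _ = (((n : ℝ) + 1) * ∑ j ∈ range (n + 1), β j ^ 2 * 4 ^ (ℓ + 1 - j))
          * ∫ x in R..X, iteratedDeriv (ℓ + 1) k x ^ 2 := by
        rw [mul_assoc, Finset.sum_mul]
        congr 1
        refine Finset.sum_congr rfl fun j _ => ?_
        ring

/-- **Velocity-data coercivity**: `∫_R^X (ladder ι n k)² ≤ C ∫_R^X (k^{(n)})²` for `k ∈ Cⁿ` with
`k^{(j)}(R) = 0` (`j < n`), `1 ≤ R ≤ X`. [folklore] -/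
theorem exists_ladder_sq_integral_le (hι : ContDiff ℝ (⊤ : ℕ∞) ι)
    (hιeq : ∀ x : ℝ, 1 / 2 ≤ x → ι x = x⁻¹) (n : ℕ) :
    ∃ C : ℝ, 0 ≤ C ∧ ∀ k : ℝ → ℝ, ContDiff ℝ n k → ∀ R X : ℝ, 1 ≤ R → R ≤ X →
      (∀ j < n, iteratedDeriv j k R = 0) →
      ∫ x in R..X, (ladder ι n k x) ^ 2 ≤ C * ∫ x in R..X, iteratedDeriv n k x ^ 2 := by
  rcases Nat.eq_zero_or_pos n with rfl | hn
  · refine ⟨1, zero_le_one, fun k _ R X _ _ _ => ?_⟩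
    simp
  · obtain ⟨C, hC0, hC⟩ := exists_ladder_weighted_sq_integral_le hι hιeq n n le_rfl hn
    refine ⟨C, hC0, fun k hk R X hR hRX hvan => ?_⟩
    have h := hC k hk R X hR hRX hvan
    simpa using h

/-- **Position-data coercivity**: for `k ∈ C^{n+1}` with `k^{(j)}(R) = 0` (`j ≤ n`), `1 ≤ R ≤ X`:
`∫_R^X ((ladder ι n k)')² + n(n+1) ι² (ladder ι n k)² ≤ C ∫_R^X (k^{(n+1)})²`. [folklore] -/
theorem exists_ladder_energy_integral_le (hι : ContDiff ℝ (⊤ : ℕ∞) ι)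
    (hιeq : ∀ x : ℝ, 1 / 2 ≤ x → ι x = x⁻¹) (n : ℕ) :
    ∃ C : ℝ, 0 ≤ C ∧ ∀ k : ℝ → ℝ, ContDiff ℝ ((n + 1 : ℕ) : ℕ∞) k → ∀ R X : ℝ, 1 ≤ R → R ≤ X →
      (∀ j ≤ n, iteratedDeriv j k R = 0) →
      ∫ x in R..X, deriv (ladder ι n k) x ^ 2 + (n : ℝ) * (n + 1) * ι x ^ 2 * (ladder ι n k x) ^ 2
        ≤ C * ∫ x in R..X, iteratedDeriv (n + 1) k x ^ 2 := by
  obtain ⟨C₁, hC₁, h₁⟩ := exists_ladder_sq_integral_le hι hιeq (n + 1)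
  obtain ⟨C₀, hC₀, h₀⟩ := exists_ladder_weighted_sq_integral_le hι hιeq n (n + 1) (Nat.le_succ n)
    (Nat.succ_pos n)
  set D : ℝ := 2 * ((n : ℝ) + 1) ^ 2 + (n : ℝ) * (n + 1) with hD
  have hD0 : 0 ≤ D := by positivity
  refine ⟨2 * C₁ + D * C₀, by positivity, fun k hk R X hR hRX hvan => ?_⟩
  have hvan1 : ∀ j < n + 1, iteratedDeriv j k R = 0 := fun j hj => hvan j (Nat.lt_succ_iff.1 hj)
  have e₁ := h₁ k (by exact_mod_cast hk) R X hR hRX hvan1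
  have e₀ := h₀ k (by exact_mod_cast hk) R X hR hRX hvan1
  simp only [Nat.add_sub_cancel_left, mul_one] at e₀
  -- pointwise: `(L₁ + (n+1)ι L₀)² + n(n+1) ι² L₀² ≤ 2 L₁² + D L₀²/x²`
  have hder : ∀ x, deriv (ladder ι n k) x
      = ladder ι (n + 1) k x + ((n : ℝ) + 1) * ι x * ladder ι n k x := by
    intro x; rw [ladder_succ, ladderStep_apply]; push_cast; ring
  have hpt : ∀ x ∈ Icc R X,
      deriv (ladder ι n k) x ^ 2 + (n : ℝ) * (n + 1) * ι x ^ 2 * (ladder ι n k x) ^ 2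
        ≤ 2 * (ladder ι (n + 1) k x) ^ 2 + D * ((ladder ι n k x) ^ 2 / x ^ 2) := by
    intro x hx
    have hx1 : 1 ≤ x := hR.trans hx.1
    have hx0 : 0 < x := by linarith
    rw [hder x, hιeq x (by linarith), hD]
    have key : (ladder ι (n + 1) k x + ((n : ℝ) + 1) * x⁻¹ * ladder ι n k x) ^ 2
        ≤ 2 * (ladder ι (n + 1) k x) ^ 2 + 2 * (((n : ℝ) + 1) * x⁻¹ * ladder ι n k x) ^ 2 := by
      nlinarith [sq_nonneg (ladder ι (n + 1) k x - ((n : ℝ) + 1) * x⁻¹ * ladder ι n k x)]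
    have e : 2 * (((n : ℝ) + 1) * x⁻¹ * ladder ι n k x) ^ 2
        + (n : ℝ) * (n + 1) * x⁻¹ ^ 2 * (ladder ι n k x) ^ 2
        = (2 * ((n : ℝ) + 1) ^ 2 + (n : ℝ) * (n + 1)) * ((ladder ι n k x) ^ 2 / x ^ 2) := by
      rw [inv_pow]; field_simp
    linarith [key, e.le, e.ge]
  -- integrability
  have hkC : ContDiff ℝ ((1 + n : ℕ) : ℕ∞) k := by rw [add_comm]; exact hk
  have hL0 : Continuous (ladder ι n k) := (contDiff_ladder hι (m := 1) hkC).continuous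
  have hL0d : Continuous (deriv (ladder ι n k)) :=
    (contDiff_ladder hι (m := 1) hkC).continuous_deriv le_rfl
  have hL1 : Continuous (ladder ι (n + 1) k) :=
    (contDiff_ladder hι (m := 0) (by simpa using hk)).continuous
  have hIlhs : IntervalIntegrable (fun x => deriv (ladder ι n k) x ^ 2
      + (n : ℝ) * (n + 1) * ι x ^ 2 * (ladder ι n k x) ^ 2) volume R X :=
    ((hL0d.pow 2).add ((continuous_const.mul (hι.continuous.pow 2)).mul (hL0.pow 2)))
      |>.intervalIntegrable _ _
  have hIq : IntervalIntegrable (fun x => (ladder ι n k x) ^ 2 / x ^ 2) volume R X := by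
    refine (ContinuousOn.div (hL0.pow 2).continuousOn (continuousOn_pow 2) ?_).intervalIntegrable
    intro x hx
    rw [uIcc_of_le hRX] at hx
    exact pow_ne_zero _ (by linarith [hx.1] : x ≠ 0)
  have hIA : IntervalIntegrable (fun x => 2 * (ladder ι (n + 1) k x) ^ 2) volume R X :=
    ((hL1.pow 2).intervalIntegrable _ _).const_mul 2
  have hIB : IntervalIntegrable (fun x => D * ((ladder ι n k x) ^ 2 / x ^ 2)) volume R X :=
    hIq.const_mul D
  have hIrhs : IntervalIntegrable (fun x => 2 * (ladder ι (n + 1) k x) ^ 2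
      + D * ((ladder ι n k x) ^ 2 / x ^ 2)) volume R X := hIA.add hIB
  calc ∫ x in R..X, deriv (ladder ι n k) x ^ 2 + (n : ℝ) * (n + 1) * ι x ^ 2 * (ladder ι n k x) ^ 2
      ≤ ∫ x in R..X, 2 * (ladder ι (n + 1) k x) ^ 2 + D * ((ladder ι n k x) ^ 2 / x ^ 2) :=
        intervalIntegral.integral_mono_on hRX hIlhs hIrhs hpt
    _ = 2 * (∫ x in R..X, (ladder ι (n + 1) k x) ^ 2)
          + D * ∫ x in R..X, (ladder ι n k x) ^ 2 / x ^ 2 := by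
        rw [intervalIntegral.integral_add hIA hIB, intervalIntegral.integral_const_mul,
          intervalIntegral.integral_const_mul]
    _ ≤ 2 * (C₁ * ∫ x in R..X, iteratedDeriv (n + 1) k x ^ 2)
          + D * (C₀ * ∫ x in R..X, iteratedDeriv (n + 1) k x ^ 2) :=
        add_le_add (mul_le_mul_of_nonneg_left e₁ (by norm_num)) (mul_le_mul_of_nonneg_left e₀ hD0)
    _ = (2 * C₁ + D * C₀) * ∫ x in R..X, iteratedDeriv (n + 1) k x ^ 2 := by ring

end Literature.Analysis.ODE
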